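import Summits.KontsevichZagierPeriods.KontsevichZagierPeriods.Theses.WZCosetWall
import Summits.KontsevichZagierPeriods.KontsevichZagierPeriods.Theorems.InverseLandauTateLiftingTriplicationThirdShift

/-!
# `TriplicationThirdShift` (stmt-KontsevichZagierPeriods-6875, route WZCosetWall) — proof

Carlson's step at Gauss triplication is a chain of Kontsevich–Zagier moves: for every rational
`x > 0`, every representation `[(0,1)², (3x+1)·z₀^{x−2/3}(1−z₀)^{x−1/3}·z₁^{2x}(1−z₁)^{x}]` and every
representation `[(0,1)², x·z₀^{x−1}(1−z₀)^{x−2/3}·z₁^{2x−2/3}(1−z₁)^{x−1/3}]` are `KZ.Equivalent`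
(the `1/3`-periodicity `(3x+1)·I(x+1/3) = x·I(x)` of `I(x) = B(x,x+1/3)·B(2x+1/3,x+2/3)`). This is
verbatim the statement proved as
`Summit.KontsevichZagierPeriods.InverseLandau.tateLifting_triplicationThirdShift` (stub
`stub_triplicationThirdShift` of line `Sketch` of crux `TateLifting`, lead c10): Beta-product algebra
in the formal period ring — one translation (integration by parts as a Newton–Leibniz move), one
reflection `t ↦ 1 − t`, one Dirichlet re-association through the open simplex.
-/

namespace Summit.KontsevichZagierPeriods.WZCosetWall

/-- **`TriplicationThirdShift`** (route WZCosetWall, stmt-KontsevichZagierPeriods-6875): for rational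
`x > 0`, `[(0,1)², (3x+1) z₀^{x−2/3}(1−z₀)^{x−1/3} z₁^{2x}(1−z₁)^{x}] ∼
[(0,1)², x z₀^{x−1}(1−z₀)^{x−2/3} z₁^{2x−2/3}(1−z₁)^{x−1/3}]` in the Kontsevich–Zagier calculus.
Proof: `InverseLandau.tateLifting_triplicationThirdShift`. [cite: AndrewsAskeyRoy1999, Thm 1.8.1] -/
theorem triplicationThirdShift_proof :
    Summit.KontsevichZagierPeriods.KontsevichZagierPeriods.Theses.WZCosetWall.TriplicationThirdShift :=
  Summit.KontsevichZagierPeriods.InverseLandau.tateLifting_triplicationThirdShift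

end Summit.KontsevichZagierPeriods.WZCosetWall
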